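import Literature.AlgebraicGeometry.Frobenioids.BirationalizationPreModel
import Literature.AlgebraicGeometry.Frobenioids.BiratLocalization
import Literature.AlgebraicGeometry.Frobenioids.DivisorMonoidBirationalProp48
import Literature.AlgebraicGeometry.Frobenioids.DivisorMonoidCategoryTheoreticityProofs
import Literature.AlgebraicGeometry.Frobenioids.EquivalenceUnitsTransport
import Literature.AlgebraicGeometry.Frobenioids.PreFrobenioidDataToFunctor
import HarnessLib

/-!
# Frobenioids I, Proposition 4.8 (iv) AS TYPED (`PreFrobenioidData.Prop48iv`) for THE birationalization
# datum `biratData hF hsq`, at the canonical "pre-model type" predicate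

Mochizuki, *The geometry of Frobenioids I: the general theory*, Kyushu J. Math. **62** (2008)
293–400, §4, Proposition 4.8 (iv), kurims text p. 88 [cite: MochizukiFrdI2008, Prop. 4.8 (iv) p.88]:
"(iv) If `C` is of isotropic and pre-model type, then so is `C^birat`." Printed proof (p. 88, last two
lines of the proof of Prop. 4.8): "assertion (iv) follows formally [from] Proposition 4.4, (iv) [cf. also
assertion (i)]".

PROOF-ONLY file (abc-iut cell, sub-DAG `FrdI:Prop4.8(iv)` = L1-lead DISCHARGE-L1 §0 row W10; seat
abc-iut-w5-d227). The mathematical content — the image of a base-Frobenius pair of `C` under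
`C → C^birat` is a base-Frobenius pair of `C^birat` — is abc-iut-L6-t20's
`PreFrobenioid.Birat.prop48iv` (`BirationalizationPreModel.lean`), a statement about the FUNCTOR
`Birat.toElemZero hF hsq : C^birat ⥤ F_{0_D}`. Seat abc-iut-L1-t3's named statement
`PreFrobenioidData.Prop48iv S B IsOfPreModelType` (`DivisorMonoidCategoryTheoreticityDefs.lean`) is a
SCHEMA: it takes "pre-model type" (Def. 2.7 (iii), seat abc-iut-L1-t2: `PreFrobenioid.IsOfPreModelType`,
a predicate on functors `C ⥤ F_Φ`) as ONE predicate parameter on operations data `PreFrobenioidData X D`,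
applied to `S` and to `B.ops`. The canonical such parameter is
`fun S ↦ PreFrobenioid.IsOfPreModelType S.toFunctor` (the operations `S` read back as the functor
`C ⥤ F_{Φ_S}` of Def. 1.1 (iv), `PreFrobenioidDataToFunctor.lean`). This file proves:

* `PreFrobenioid.isOfPreModelType_toFunctor_ofFunctor_iff` (row P48iv-L05): for every pre-Frobenioid
  `G : X ⥤ F_Ψ`, "pre-model type" is insensitive to the round trip `G ↦ (ofFunctor Ψ G).toFunctor`
  (same category, same operations: base-sections and Frobenius-sections of the one are those of the
  other) — so the canonical parameter evaluated at `ofFunctor Φ F` IS `IsOfPreModelType F`, and at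
  `(biratData hF hsq).ops = ofFunctor 0_D (Birat.toElemZero hF hsq)` IS
  `IsOfPreModelType (Birat.toElemZero hF hsq)`;
* `PreFrobenioid.prop48iv_biratData` (row P48iv-L06): **[FrdI] Prop. 4.8 (iv) AS TYPED (`Prop48iv`) HOLDS
  for THE birationalization datum of a Frobenioid at the canonical predicate.**

UNIVERSE NOTE (census finding, not a defect of print): the schema quantifies its predicate parameter over
`{X : Type u} [Category.{v} X]` with the object AND morphism universes of `C`, and applies it to
`B.ops`; hence `Prop48iv S B _` only elaborates for birationalization data `B` whose category `C^birat`
has its morphisms in the SAME universe as `C`. THE birationalization `Birat F hF hsq` has objects in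
`Type u'` and morphisms in `Type (max u' v')` (classes of fractions), so the schema is instantiable at
`biratData hF hsq` exactly when `C : Type u'` carries `Category.{max u' v'}` — e.g. every small category
(`u' = v'`). `prop48iv_biratData` is stated in that generality; the universe-unrestricted statement is the
functor-level `PreFrobenioid.Birat.prop48iv`. (A schema with two predicate parameters, one per side, would
be instantiable in general; recorded in the W10 sub-DAG census for abc-iut-L1-t3's successor.)

ERRATUM NOTE (author's *Comments on [FrdI]*, Jan. 2024, item (29)(iv)): "pre-model type" in
Prop. 4.8 (iv) is to be read "model type" (Def. 4.5 (i): pre-model AND birationally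
Frobenius-normalized). The typed node and this file follow the 2008 text; the additional transfer of
birational Frobenius-normalization to `C^birat` is row P48iv-L07 of the sub-DAG (not proved here).

No definitions; no statement of the paper is strengthened; nothing here concerns the disputed parts of
IUT (no side taken on [IUTchIII] Cor. 3.12).
-/

namespace Literature.AlgebraicGeometry.Frobenioids

open CategoryTheory Opposite

namespace PreFrobenioid

universe w v v' u u'

section RoundTrip

variable {D : Type u} [Category.{v} D] {Ψ : Dᵒᵖ ⥤ CommMonCat.{w}}
  {X : Type u'} [Category.{v'} X] (G : X ⥤ ElemFrobenioid Ψ)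

/-- Pull-back morphisms of the round-trip functor `(ofFunctor Ψ G).toFunctor : X ⥤ F_{Φ_S}` are the
pull-back morphisms of `G` (same operations). [cite: MochizukiFrdI2008, Def. 1.2 (ii) p.21] -/
theorem isPullbackMorphism_toFunctor_ofFunctor_iff {A B : X} (f : A ⟶ B) :
    IsPullbackMorphism (PreFrobenioidData.ofFunctor Ψ G).toFunctor f ↔ IsPullbackMorphism G f := by
  rw [← PreFrobenioidData.ofFunctor_isPullbackMorphism G f,
    ← PreFrobenioidData.ofFunctor_isPullbackMorphism (PreFrobenioidData.ofFunctor Ψ G).toFunctor f,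
    PreFrobenioidData.ofFunctor_toFunctor]

/-- Frobenius-trivial objects of the round-trip functor are those of `G`.
[cite: MochizukiFrdI2008, Def. 1.2 (iv) p.22] -/
theorem isFrobeniusTrivial_toFunctor_ofFunctor_iff (A : X) :
    IsFrobeniusTrivial (PreFrobenioidData.ofFunctor Ψ G).toFunctor A ↔ IsFrobeniusTrivial G A := by
  rw [← PreFrobenioidData.ofFunctor_isFrobeniusTrivial G A,
    ← PreFrobenioidData.ofFunctor_isFrobeniusTrivial (PreFrobenioidData.ofFunctor Ψ G).toFunctor A,
    PreFrobenioidData.ofFunctor_toFunctor]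

/-- Arrows of Frobenius type of the round-trip functor are those of `G`.
[cite: MochizukiFrdI2008, Def. 1.2 (iii) p.22] -/
theorem isFrobeniusType_toFunctor_ofFunctor_iff {A B : X} (f : A ⟶ B) :
    IsFrobeniusType (PreFrobenioidData.ofFunctor Ψ G).toFunctor f ↔ IsFrobeniusType G f := by
  rw [← PreFrobenioidData.ofFunctor_isFrobeniusType G f,
    ← PreFrobenioidData.ofFunctor_isFrobeniusType (PreFrobenioidData.ofFunctor Ψ G).toFunctor f,
    PreFrobenioidData.ofFunctor_toFunctor]

/-- Base-identity endomorphisms of the round-trip functor are those of `G`.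
[cite: MochizukiFrdI2008, Def. 1.2 (ii) p.21] -/
theorem isBaseIdentity_toFunctor_ofFunctor_iff {A : X} (f : A ⟶ A) :
    IsBaseIdentity (PreFrobenioidData.ofFunctor Ψ G).toFunctor f ↔ IsBaseIdentity G f := Iff.rfl

/-- Frobenius degrees of the round-trip functor are those of `G`. [cite: MochizukiFrdI2008, Def. 1.1 (iv) p.20] -/
theorem degFr_toFunctor_ofFunctor {A B : X} (f : A ⟶ B) :
    degFr (PreFrobenioidData.ofFunctor Ψ G).toFunctor f = degFr G f := rfl

/-- The base functor of the round-trip functor is that of `G`. [cite: MochizukiFrdI2008, Def. 1.1 (iv) p.20] -/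
theorem baseFunctor_toFunctor_ofFunctor :
    baseFunctor (PreFrobenioidData.ofFunctor Ψ G).toFunctor = baseFunctor G := rfl

/-- A subcategory `P ⊆ X` is a base-section (Def. 2.7 (i)) for the round-trip functor iff it is one for
`G`. [cite: MochizukiFrdI2008, Def. 2.7 (i) p.51] -/
theorem isBaseSection_toFunctor_ofFunctor_iff (P : Presection X) :
    IsBaseSection (PreFrobenioidData.ofFunctor Ψ G).toFunctor P ↔ IsBaseSection G P := by
  constructor
  · intro h
    exact ⟨fun f hf => (isPullbackMorphism_toFunctor_ofFunctor_iff G f).mp (h.hom_pullback f hf),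
      h.isSkeleton, fun A hA => (isFrobeniusTrivial_toFunctor_ofFunctor_iff G A).mp
        (h.isFrobeniusTrivial A hA), h.isEquivalence⟩
  · intro h
    exact ⟨fun f hf => (isPullbackMorphism_toFunctor_ofFunctor_iff G f).mpr (h.hom_pullback f hf),
      h.isSkeleton, fun A hA => (isFrobeniusTrivial_toFunctor_ofFunctor_iff G A).mpr
        (h.isFrobeniusTrivial A hA), h.isEquivalence⟩

/-- A homomorphism `Fr : ℕ_{≥1} → End(P ↪ X)` is a `P`-Frobenius-section (Def. 2.7 (ii)) for the
round-trip functor iff it is one for `G`. [cite: MochizukiFrdI2008, Def. 2.7 (ii) p.51] -/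
theorem isFrobeniusSection_toFunctor_ofFunctor_iff (P : Presection X) (Fr : ℕ+ →* End P.ι) :
    IsFrobeniusSection (PreFrobenioidData.ofFunctor Ψ G).toFunctor P Fr ↔ IsFrobeniusSection G P Fr := by
  constructor
  · intro h
    exact ⟨h.degFr_eq, h.isBaseIdentity,
      fun n A => (isFrobeniusType_toFunctor_ofFunctor_iff G _).mp (h.isFrobeniusType n A)⟩
  · intro h
    exact ⟨h.degFr_eq, h.isBaseIdentity,
      fun n A => (isFrobeniusType_toFunctor_ofFunctor_iff G _).mpr (h.isFrobeniusType n A)⟩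

/-- Base-Frobenius pairs (Def. 2.7 (iii)) of the round-trip functor are those of `G`.
[cite: MochizukiFrdI2008, Def. 2.7 (iii) p.52] -/
theorem isBaseFrobeniusPair_toFunctor_ofFunctor_iff (P : Presection X) (Fr : ℕ+ →* End P.ι) :
    IsBaseFrobeniusPair (PreFrobenioidData.ofFunctor Ψ G).toFunctor P Fr ↔
      IsBaseFrobeniusPair G P Fr :=
  ⟨fun h => ⟨(isBaseSection_toFunctor_ofFunctor_iff G P).mp h.isBaseSection,
      (isFrobeniusSection_toFunctor_ofFunctor_iff G P Fr).mp h.isFrobeniusSection⟩,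
    fun h => ⟨(isBaseSection_toFunctor_ofFunctor_iff G P).mpr h.isBaseSection,
      (isFrobeniusSection_toFunctor_ofFunctor_iff G P Fr).mpr h.isFrobeniusSection⟩⟩

/-- **Row P48iv-L05.** "Pre-model type" (Def. 2.7 (iii)) is insensitive to the round trip
`G ↦ (ofFunctor Ψ G).toFunctor` (operations of a functor, read back as a functor): the canonical
operations-level reading `S ↦ IsOfPreModelType S.toFunctor` of the predicate parameter of the schema
`PreFrobenioidData.Prop48iv`, evaluated at `ofFunctor Ψ G`, is `IsOfPreModelType G`.
[cite: MochizukiFrdI2008, Def. 2.7 (iii) p.52] -/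
theorem isOfPreModelType_toFunctor_ofFunctor_iff :
    IsOfPreModelType (PreFrobenioidData.ofFunctor Ψ G).toFunctor ↔ IsOfPreModelType G :=
  ⟨fun ⟨P, Fr, h⟩ => ⟨P, Fr, (isBaseFrobeniusPair_toFunctor_ofFunctor_iff G P Fr).mp h⟩,
    fun ⟨P, Fr, h⟩ => ⟨P, Fr, (isBaseFrobeniusPair_toFunctor_ofFunctor_iff G P Fr).mpr h⟩⟩

end RoundTrip

section Prop48iv

variable {D : Type u} [Category.{v} D] {Φ : Dᵒᵖ ⥤ CommMonCat.{w}}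
  {C : Type u'} [Category.{max u' v'} C] {F : C ⥤ ElemFrobenioid Φ}
  (hF : IsFrobenioid F) (hsq : HasBiratSquares F)

/-- **Row P48iv-L06 — [FrdI] Prop. 4.8 (iv) AS TYPED (`Prop48iv`)** for THE birationalization datum
`biratData hF hsq` of a Frobenioid `F : C ⥤ F_Φ`, at the canonical "pre-model type" predicate
`S ↦ IsOfPreModelType S.toFunctor`: "If `C` is of isotropic and pre-model type, then so is `C^birat`."
The isotropic half is abc-iut-L6-t20's `prop48i_biratData`; the pre-model half is abc-iut-L6-t20's
`Birat.isOfPreModelType` transported along row P48iv-L05 on both sides. (`C` with morphisms in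
`Type (max u' v')`: see the UNIVERSE NOTE of the module docstring.) [cite: MochizukiFrdI2008, Prop. 4.8 (iv) p.88] -/
theorem prop48iv_biratData :
    (PreFrobenioidData.ofFunctor Φ F).Prop48iv (biratData hF hsq)
      (fun S => IsOfPreModelType S.toFunctor) := by
  intro hiso hpm
  refine ⟨prop48i_biratData hF hsq hiso, ?_⟩
  have hiso' : IsOfIsotropicType F := (PreFrobenioidData.ofFunctor_isOfIsotropicType F).mp hiso
  have hpm' : IsOfPreModelType F := (isOfPreModelType_toFunctor_ofFunctor_iff F).mp hpm
  exact (isOfPreModelType_toFunctor_ofFunctor_iff (Birat.toElemZero hF hsq)).mpr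
    (Birat.isOfPreModelType hF hsq hiso' hpm')

/-- **[FrdI] Prop. 4.8 (iv) AS TYPED, for every Frobenioid** (the square-completion hypothesis
`HasBiratSquares` of the construction of `C^birat` is Prop. 1.11 (vii), discharged for every Frobenioid by
abc-iut-L6-t6's `hasBiratSquares_of_isFrobenioid`). [cite: MochizukiFrdI2008, Prop. 4.8 (iv) p.88] -/
theorem prop48iv_biratData_of_isFrobenioid (hF : IsFrobenioid F) :
    (PreFrobenioidData.ofFunctor Φ F).Prop48iv (biratData hF (hasBiratSquares_of_isFrobenioid hF))
      (fun S => IsOfPreModelType S.toFunctor) :=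
  prop48iv_biratData hF (hasBiratSquares_of_isFrobenioid hF)

end Prop48iv

end PreFrobenioid

end Literature.AlgebraicGeometry.Frobenioids
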